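import Literature.Computability.AlgebraicComplexity.IMMWalkExpansion
import Literature.Computability.AlgebraicComplexity.HomDepthFourSubstUpperBound
import HarnessLib

/-!
# `0/1`-substitutions and derivatives of `IMM` in terms of walks (Kumar–Saraf 2017, §8.1–§8.5)

Topic `Literature/Computability/AlgebraicComplexity`; infrastructure for the printed proof of
`kumarSaraf2017_imm_homDepthFour` (`HomogeneousDepthFour.lean`). With `IMM = ∑_v x^{walk v}`
(`IMMWalk.immPoly_eq_sum_closedWalks`) and the `0/1`-substitutions `ρ_{J,V} = substVars J V` of
`HomDepthFourSubstUpperBound.lean` (the all-ones matrices `J` of `IMM^*`, [KS, §8.1], and the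
random restriction `V`, [KS, §8.3]), the substituted polynomial and its derivatives along a
monomial `α` (a duplicate-free list `L` of variables) are sums with coefficient `1` over explicit
sets of closed walks:

* `aliveWalks J V` — the closed walks all of whose non-`J` variables lie in `V`;
  `substVars_immPoly`: `ρ_{J,V} IMM = ∑_{v alive} x^{walk v ∖ J}`.
* `iterPderiv_monomial_one_of_le_one` — the derivative of a multilinear monic monomial along `L`.
* `derivWalks J V L` — the alive walks through all the variables of `L` (off `J`);
  **`iterPderiv_substVars_immPoly`**: `∂_L ρ_{J,V} IMM = ∑_{v ∈ derivWalks} x^{walk v ∖ J - 1_L}`;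
  `exists_of_mem_support_deriv` (every monomial of the derivative has this form),
  `isML_of_mem_support_deriv` (multilinearity: the hypothesis of
  `KumarSaraf.pspDim_mul_ge_of_T123`), and, when the walks are recoverable from their non-`J`
  variables (`Set.InjOn (v ↦ walk v ∖ J)` on the alive walks — true for the block layout of
  `IMM^*`, where a `J`-step always leads to the row `0` of the next special matrix),
  `coeff_deriv_eq_one` and `mem_support_deriv_iff` (the support is EXACTLY that set: the set
  `S|_V(α)` of extensions of `α`, [KS, §8.1]).

Everything is proved; no named facts.

## References

* M. Kumar, S. Saraf, *On the power of homogeneous depth 4 arithmetic circuits*, SIAM J. Comput.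
  46 (2017) 336–387 (arXiv:1404.1950): §8.1 (`IMM^*`, `S(α)`), §8.3 (`IMM|_V`), §8.5.
-/

noncomputable section

open MvPolynomial

namespace Literature.Computability.AlgebraicComplexity

namespace IMMWalk

open KumarSaraf GKKS

universe u

variable {N d : ℕ} {K : Type u} [CommRing K]

/-! ### The substituted polynomial -/

/-- The closed walks alive under `ρ_{J,V}`: all their variables outside `J` lie in `V`.
[cite: KumarSaraf2017, §8.3] -/
def aliveWalks (J V : Finset (Fin d × Fin N × Fin N)) : Finset (Fin d → Fin N) :=
  Finset.univ.filter fun v => (closedWalkExp v).support \ J ⊆ V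

/-- **`ρ_{J,V} IMM` is the sum over the alive closed walks of their monomials with the
`J`-variables erased.** [cite: KumarSaraf2017, §8.3] -/
theorem substVars_immPoly (hd : 0 < d) (J V : Finset (Fin d × Fin N × Fin N)) :
    substVars J V (immPoly N d K) =
      ∑ v ∈ aliveWalks J V, monomial (eraseVars J (closedWalkExp v)) 1 := by
  classical
  rw [immPoly_eq_sum_closedWalks N d K hd, map_sum]
  simp only [substVars_monomial]
  rw [aliveWalks, Finset.sum_filter]

/-- The erased walk exponent vectors are multilinear. [cite: KumarSaraf2017, §8.3] -/
theorem eraseVars_closedWalkExp_le_one (J : Finset (Fin d × Fin N × Fin N)) (v : Fin d → Fin N)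
    (x : Fin d × Fin N × Fin N) : eraseVars J (closedWalkExp v) x ≤ 1 := by
  rw [eraseVars, Finsupp.filter_apply]
  split_ifs
  · exact Nat.zero_le _
  · exact closedWalkExp_le_one v x

/-! ### Derivatives of multilinear monomials -/

omit [CommRing K] in
/-- **The derivative of a multilinear monic monomial along a duplicate-free list `L`** is
`x^{e - 1_L}` if every variable of `L` occurs in `x^e`, and `0` otherwise. [folklore] -/
theorem iterPderiv_monomial_one_of_le_one {σ : Type*} [DecidableEq σ] {R : Type*} [CommRing R]
    (L : List σ) (hL : L.Nodup) (e : σ →₀ ℕ) (he : ∀ x, e x ≤ 1) :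
    iterPderiv L (monomial e (1 : R)) =
      if ∀ x ∈ L, x ∈ e.support then monomial (e - listInd L) 1 else 0 := by
  rw [iterPderiv_monomial L hL e 1, one_mul]
  split_ifs with h
  · congr 1
    rw [List.prod_eq_one]
    intro c hc
    obtain ⟨x, hx, rfl⟩ := List.mem_map.1 hc
    have h1 := Finsupp.mem_support_iff.1 (h x hx)
    have h2 := he x
    have : e x = 1 := by omega
    rw [this, Nat.cast_one]
  · push Not at h
    obtain ⟨x, hx, hxe⟩ := h
    rw [Finsupp.notMem_support_iff] at hxe
    have h0 : (L.map fun v => (e v : R)).prod = 0 :=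
      List.prod_eq_zero (List.mem_map.2 ⟨x, hx, by rw [hxe, Nat.cast_zero]⟩)
    rw [h0, monomial_zero]

/-- The indicator of a duplicate-free list lies below any multilinear vector containing its
variables. [folklore] -/
theorem listInd_le_of_subset {σ : Type*} {L : List σ} (hL : L.Nodup) {e : σ →₀ ℕ}
    (h : ∀ x ∈ L, x ∈ e.support) : listInd L ≤ e := by
  intro x
  by_cases hx : x ∈ L
  · rw [listInd_apply_of_mem hL hx]
    exact Nat.one_le_iff_ne_zero.2 (Finsupp.mem_support_iff.1 (h x hx))
  · rw [listInd_apply_of_not_mem hx]; exact Nat.zero_le _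

/-! ### Derivatives of the substituted polynomial -/

/-- The alive closed walks through every variable of `L` (the extensions of `α`, [KS, §8.1]).
[cite: KumarSaraf2017, §8.1] -/
def derivWalks (J V : Finset (Fin d × Fin N × Fin N)) (L : List (Fin d × Fin N × Fin N)) :
    Finset (Fin d → Fin N) :=
  (aliveWalks J V).filter fun v => ∀ x ∈ L, x ∈ (eraseVars J (closedWalkExp v)).support

/-- **`∂_L ρ_{J,V} IMM` is the sum over the alive walks through `L`** of the monomials
`x^{walk v ∖ J - 1_L}`. [cite: KumarSaraf2017, §8.5] -/
theorem iterPderiv_substVars_immPoly (hd : 0 < d) (J V : Finset (Fin d × Fin N × Fin N))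
    {L : List (Fin d × Fin N × Fin N)} (hL : L.Nodup) :
    iterPderiv L (substVars J V (immPoly N d K)) =
      ∑ v ∈ derivWalks J V L, monomial (eraseVars J (closedWalkExp v) - listInd L) 1 := by
  classical
  rw [substVars_immPoly hd J V, map_sum, derivWalks, Finset.sum_filter]
  refine Finset.sum_congr rfl fun v _ => ?_
  rw [iterPderiv_monomial_one_of_le_one (R := K) L hL _ (eraseVars_closedWalkExp_le_one J v)]
  split_ifs <;> rfl

/-- Every monomial of `∂_L ρ_{J,V} IMM` is `x^{walk v ∖ J - 1_L}` for an alive walk `v` through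
`L`. [cite: KumarSaraf2017, §8.5] -/
theorem exists_of_mem_support_deriv (hd : 0 < d) (J V : Finset (Fin d × Fin N × Fin N))
    {L : List (Fin d × Fin N × Fin N)} (hL : L.Nodup) {β : (Fin d × Fin N × Fin N) →₀ ℕ}
    (hβ : β ∈ (iterPderiv L (substVars J V (immPoly N d K))).support) :
    ∃ v ∈ derivWalks J V L, β = eraseVars J (closedWalkExp v) - listInd L := by
  classical
  rw [iterPderiv_substVars_immPoly hd J V hL] at hβ
  obtain ⟨v, hv, hβv⟩ := Finset.mem_biUnion.1 (support_sum hβ)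
  refine ⟨v, hv, ?_⟩
  have := support_monomial_subset hβv
  rwa [Finset.mem_singleton] at this

/-- **The derivatives of `ρ_{J,V} IMM` have multilinear monomials** (the hypothesis of the
lower-bound skeleton `KumarSaraf.pspDim_mul_ge_of_T123`). [cite: KumarSaraf2017, §8.5] -/
theorem isML_of_mem_support_deriv (hd : 0 < d) (J V : Finset (Fin d × Fin N × Fin N))
    {L : List (Fin d × Fin N × Fin N)} (hL : L.Nodup) {β : (Fin d × Fin N × Fin N) →₀ ℕ}
    (hβ : β ∈ (iterPderiv L (substVars J V (immPoly N d K))).support) : IsML β := by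
  obtain ⟨v, -, rfl⟩ := exists_of_mem_support_deriv hd J V hL hβ
  intro x
  rw [Finsupp.tsub_apply]
  exact (Nat.sub_le _ _).trans (eraseVars_closedWalkExp_le_one J v x)

/-! ### Exact support, when the walks are recoverable from their non-`J` variables -/

/-- Removing `1_L` from erased walk vectors through `L` is one-to-one when the erased walk
vectors themselves determine the walks (on the alive walks). [cite: KumarSaraf2017, §8.5] -/
theorem sub_listInd_inj {J V : Finset (Fin d × Fin N × Fin N)} {L : List (Fin d × Fin N × Fin N)}
    (hL : L.Nodup)
    (hinj : Set.InjOn (fun v : Fin d → Fin N => eraseVars J (closedWalkExp v)) ↑(aliveWalks J V))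
    {v w : Fin d → Fin N} (hv : v ∈ derivWalks J V L) (hw : w ∈ derivWalks J V L)
    (h : eraseVars J (closedWalkExp v) - listInd L = eraseVars J (closedWalkExp w) - listInd L) :
    v = w := by
  rw [derivWalks, Finset.mem_filter] at hv hw
  refine hinj (Finset.mem_coe.2 hv.1) (Finset.mem_coe.2 hw.1) ?_
  simp only
  rw [← tsub_add_cancel_of_le (listInd_le_of_subset hL hv.2), h,
    tsub_add_cancel_of_le (listInd_le_of_subset hL hw.2)]

/-- **The coefficient of `x^{walk v ∖ J - 1_L}` in `∂_L ρ_{J,V} IMM` is `1`** (recoverable walks).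
[cite: KumarSaraf2017, §8.5] -/
theorem coeff_deriv_eq_one (hd : 0 < d) {J V : Finset (Fin d × Fin N × Fin N)}
    {L : List (Fin d × Fin N × Fin N)} (hL : L.Nodup)
    (hinj : Set.InjOn (fun v : Fin d → Fin N => eraseVars J (closedWalkExp v)) ↑(aliveWalks J V))
    {v : Fin d → Fin N} (hv : v ∈ derivWalks J V L) :
    coeff (eraseVars J (closedWalkExp v) - listInd L)
      (iterPderiv L (substVars J V (immPoly N d K))) = 1 := by
  classical
  rw [iterPderiv_substVars_immPoly hd J V hL, coeff_sum]
  simp only [coeff_monomial]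
  rw [Finset.sum_eq_single v]
  · rw [if_pos rfl]
  · intro w hw hwv
    rw [if_neg]
    exact fun h => hwv (sub_listInd_inj hL hinj hw hv h)
  · intro h; exact absurd hv h

/-- **The support of `∂_L ρ_{J,V} IMM` is exactly `{x^{walk v ∖ J - 1_L} : v alive through L}`**
(recoverable walks, nontrivial coefficients) — the set `S|_V(α)` of [KS, §8.1] in the block
layout. [cite: KumarSaraf2017, §8.1] -/
theorem mem_support_deriv_iff [Nontrivial K] (hd : 0 < d) {J V : Finset (Fin d × Fin N × Fin N)}
    {L : List (Fin d × Fin N × Fin N)} (hL : L.Nodup)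
    (hinj : Set.InjOn (fun v : Fin d → Fin N => eraseVars J (closedWalkExp v)) ↑(aliveWalks J V))
    {β : (Fin d × Fin N × Fin N) →₀ ℕ} :
    β ∈ (iterPderiv L (substVars J V (immPoly N d K))).support ↔
      ∃ v ∈ derivWalks J V L, β = eraseVars J (closedWalkExp v) - listInd L := by
  constructor
  · exact exists_of_mem_support_deriv hd J V hL
  · rintro ⟨v, hv, rfl⟩
    rw [mem_support_iff, coeff_deriv_eq_one hd hL hinj hv]
    exact one_ne_zero

/-- **The support of `∂_L ρ_{J,V} IMM` is in bijection with the alive walks through `L`**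
(recoverable walks): its cardinality is `|derivWalks J V L|`. [cite: KumarSaraf2017, §8.1] -/
theorem card_support_deriv [Nontrivial K] (hd : 0 < d) {J V : Finset (Fin d × Fin N × Fin N)}
    {L : List (Fin d × Fin N × Fin N)} (hL : L.Nodup)
    (hinj : Set.InjOn (fun v : Fin d → Fin N => eraseVars J (closedWalkExp v)) ↑(aliveWalks J V)) :
    (iterPderiv L (substVars J V (immPoly N d K))).support.card = (derivWalks J V L).card := by
  classical
  have h : (iterPderiv L (substVars J V (immPoly N d K))).support =
      (derivWalks J V L).image fun v => eraseVars J (closedWalkExp v) - listInd L := by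
    ext β
    rw [mem_support_deriv_iff hd hL hinj, Finset.mem_image]
    constructor
    · rintro ⟨v, hv, rfl⟩; exact ⟨v, hv, rfl⟩
    · rintro ⟨v, hv, rfl⟩; exact ⟨v, hv, rfl⟩
  rw [h, Finset.card_image_of_injOn]
  intro v hv w hw hvw
  exact sub_listInd_inj hL hinj (Finset.mem_coe.1 hv) (Finset.mem_coe.1 hw) hvw

/-- The number of variables of `x^{walk v ∖ J - 1_L}`: those of the walk outside `J`, minus `|L|`.
[cite: KumarSaraf2017, §8.5] -/
theorem card_support_sub_listInd {J : Finset (Fin d × Fin N × Fin N)}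
    {L : List (Fin d × Fin N × Fin N)} (hL : L.Nodup) {v : Fin d → Fin N}
    (hv : ∀ x ∈ L, x ∈ (eraseVars J (closedWalkExp v)).support) :
    (eraseVars J (closedWalkExp v) - listInd L).support.card =
      ((closedWalkExp v).support \ J).card - L.length := by
  classical
  have hsupp : (eraseVars J (closedWalkExp v) - listInd L).support =
      (eraseVars J (closedWalkExp v)).support \ L.toFinset := by
    ext x
    rw [Finsupp.mem_support_iff, Finsupp.tsub_apply, Finset.mem_sdiff, Finsupp.mem_support_iff,
      List.mem_toFinset]
    have h1 := eraseVars_closedWalkExp_le_one J v x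
    by_cases hx : x ∈ L
    · rw [listInd_apply_of_mem hL hx]
      constructor
      · intro h; omega
      · intro h; exact absurd hx h.2
    · rw [listInd_apply_of_not_mem hx]
      simp [hx]
  rw [hsupp, Finset.card_sdiff_of_subset, support_eraseVars, List.toFinset_card_of_nodup hL]
  intro x hx
  exact hv x (List.mem_toFinset.1 hx)

end IMMWalk

end Literature.Computability.AlgebraicComplexity

end
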